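import Summits.AtomisticToContinuum.HydrodynamicLimit.Theses.MourreKoopmanCharges
import Literature.Analysis.FunctionSpaces.PointConfigVagueTopology
import HarnessLib

/-!
# `StressStrongMixing` · line `birth`, stub F3static: non-negativity of the zero-wavenumber structure factor
# (the Følner / Gaussian-window positivity lemma behind the field `form_self_nonneg` of Spohn's `ℋ`)

Support file for the crux item stmt-AtomisticToContinuum-9584 (`StressStrongMixing`, route `MourreKoopmanCharges` of
`AtomisticToContinuum/HydrodynamicLimit`), line `birth`, registered stub `stub_momentsAndPositivity` (second conjunct).
`Literature.MathematicalPhysics.KineticTheory.FluctuationStructure` takes `0 ≤ ∫ Cov_μ(a, a ∘ τ_x) dx` as a FIELD and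
remarks that it "follows from translation invariance + summable clustering by a Følner average … which for `G = ℝ³` needs
joint measurability of the action and Fubini; any concrete instance must supply it".  This file supplies it, for any
jointly measurable measure-preserving action `T` of `ℝ³` on a probability space and any MEASURABLE `f ∈ L²(μ)` with
integrable `x ↦ Cov_μ(f, f ∘ T_x)`:

  `integral_cov_shift_nonneg : 0 ≤ ∫ x, cov[f, f ∘ T x; μ]`.

Proof (Gaussian windows instead of boxes).  Centre `f`.  For `a > 0` put `w(x) = e^{-a|x|²}` and
`F(ω) = ∫ w(x) f(T_x ω) dx`; then `0 ≤ E[F²] = ∫∫ w(x) w(y) Cov(f ∘ T_x, f ∘ T_y) dx dy = ∫∫ w(x) w(y) g(y - x) dx dy`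
(`g(z) = Cov(f, f ∘ T_z)`, stationarity; one Fubini on `μ ⊗ (dx ⊗ dy)`, legitimate because
`|w(x)w(y)f(T_xω)f(T_yω)| ≤ w(x)w(y)(f(T_xω)² + f(T_yω)²)/2` has finite integral `(∫w)²‖f‖₂²`), and
`∫ w(x) w(x+z) dx = e^{-a|z|²/2} ∫ e^{-2a|x+z/2|²} dx = C_a e^{-a|z|²/2}`, `C_a > 0`, so `0 ≤ ∫ e^{-a|z|²/2} g(z) dz` for
every `a > 0`; dominated convergence as `a → 0⁺` gives `0 ≤ ∫ g`.

References: B. Doyon, CMP 391 (2022), Lemma 4.5; H. Spohn, *Large Scale Dynamics of Interacting Particles* (1991), Part I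
(7.6) (`⟨⟨a,a⟩⟩ = lim |Λ|⁻¹ Var(∫_Λ a ∘ τ_x dx) ≥ 0`).
-/

noncomputable section

open MeasureTheory ProbabilityTheory Filter Topology Real
open scoped InnerProductSpace ENNReal

namespace Summit.AtomisticToContinuum.HydrodynamicLimit.Theorems.MourreKoopmanChargesStressStrongMixing

open Literature.MathematicalPhysics.KineticTheory Literature.Analysis.FluidPDE

/-! ### Gaussian windows on `ℝ³` -/

/-- The Gaussian window `e^{-a|x|²}` is integrable on `ℝ³` for `a > 0` (norm of the complex Gaussian). [folklore] -/
theorem integrable_gaussWindow {a : ℝ} (ha : 0 < a) : Integrable (fun x : V3 => rexp (-a * ‖x‖ ^ 2)) volume := by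
  have h := (GaussianFourier.integrable_cexp_neg_mul_sq_norm_add (V := V3) (b := (a : ℂ)) (by simpa using ha) 0 0).norm
  refine h.congr (Eventually.of_forall fun x => ?_)
  simp only [zero_mul, add_zero]
  rw [show -(a : ℂ) * (‖x‖ : ℂ) ^ 2 = ((-a * ‖x‖ ^ 2 : ℝ) : ℂ) by push_cast; ring, Complex.norm_exp_ofReal]

/-- The Gaussian window has positive integral. [folklore] -/
theorem integral_gaussWindow_pos {a : ℝ} (ha : 0 < a) : 0 < ∫ x : V3, rexp (-a * ‖x‖ ^ 2) := by
  rw [GaussianFourier.integral_rexp_neg_mul_sq_norm ha]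
  positivity

/-- **The Gaussian window autocorrelation**: `e^{-a|x|²} e^{-a|x+z|²} = e^{-a|z|²/2} e^{-2a|x + z/2|²}`
(`|x|² + |x+z|² = 2|x + z/2|² + |z|²/2`). [folklore] -/
theorem gaussWindow_mul_gaussWindow_add (a : ℝ) (x z : V3) :
    rexp (-a * ‖x‖ ^ 2) * rexp (-a * ‖x + z‖ ^ 2) =
      rexp (-(a / 2) * ‖z‖ ^ 2) * rexp (-(2 * a) * ‖x + (1 / 2 : ℝ) • z‖ ^ 2) := by
  rw [← Real.exp_add, ← Real.exp_add]
  congr 1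
  have h1 : ‖x + z‖ ^ 2 = ‖x‖ ^ 2 + 2 * ⟪x, z⟫_ℝ + ‖z‖ ^ 2 := norm_add_sq_real x z
  have h2 : ‖x + (1 / 2 : ℝ) • z‖ ^ 2 = ‖x‖ ^ 2 + 2 * ⟪x, (1 / 2 : ℝ) • z⟫_ℝ + ‖(1 / 2 : ℝ) • z‖ ^ 2 :=
    norm_add_sq_real x _
  rw [real_inner_smul_right, norm_smul, Real.norm_eq_abs, abs_of_pos (by norm_num : (0 : ℝ) < 1 / 2)] at h2
  rw [h1, h2]
  ring

/-- `∫ e^{-a|x|²} e^{-a|x+z|²} dx = e^{-a|z|²/2} · ∫ e^{-2a|x|²} dx` (translation invariance of Lebesgue measure). [folklore] -/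
theorem integral_gaussWindow_mul_gaussWindow_add (a : ℝ) (z : V3) :
    ∫ x : V3, rexp (-a * ‖x‖ ^ 2) * rexp (-a * ‖x + z‖ ^ 2) =
      rexp (-(a / 2) * ‖z‖ ^ 2) * ∫ x : V3, rexp (-(2 * a) * ‖x‖ ^ 2) := by
  simp_rw [gaussWindow_mul_gaussWindow_add a _ z]
  rw [integral_const_mul]
  congr 1
  exact integral_add_right_eq_self (fun x : V3 => rexp (-(2 * a) * ‖x‖ ^ 2)) ((1 / 2 : ℝ) • z)

/-! ### The positivity lemma -/

section Positivity

variable {Ω : Type*} [MeasurableSpace Ω] {μ : Measure Ω} [IsProbabilityMeasure μ] {T : V3 → Ω → Ω}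

omit [IsProbabilityMeasure μ] in
/-- Stationarity of two-point functions of a centred observable along the action:
`∫ f(T_x ω) f(T_y ω) dμ = ∫ f · (f ∘ T_{y-x}) dμ` (`T_y = T_{y-x} ∘ T_x`, `T_x` preserves `μ`). [folklore] -/
theorem integral_mul_shift_shift (hT : ∀ x, MeasurePreserving (T x) μ μ)
    (hTadd : ∀ x y, T (x + y) = T x ∘ T y) {f : Ω → ℝ} (hfm : Measurable f) (x y : V3) :
    ∫ ω, f (T x ω) * f (T y ω) ∂μ = ∫ ω, f ω * f (T (y - x) ω) ∂μ := by
  have hy : T y = T (y - x) ∘ T x := by rw [← hTadd, sub_add_cancel]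
  have hmeas : AEStronglyMeasurable (fun ω => f ω * f (T (y - x) ω)) (μ.map (T x)) := by
    rw [(hT x).map_eq]
    exact (hfm.mul (hfm.comp (hT (y - x)).measurable)).aestronglyMeasurable
  have key : ∫ ω, f ω * f (T (y - x) ω) ∂(μ.map (T x)) = ∫ ω, (fun ω' => f ω' * f (T (y - x) ω')) (T x ω) ∂μ :=
    integral_map (hT x).measurable.aemeasurable hmeas
  rw [(hT x).map_eq] at key
  rw [key]
  refine integral_congr_ae (Eventually.of_forall fun ω => ?_)
  simp only [hy, Function.comp_apply]

/-- **Finite integral of the dominating function** `w(x) w(y) f(T_x ω)²` on `μ ⊗ (dx ⊗ dy)` (Tonelli; the value is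
`(∫ w)² ‖f‖₂²`). [folklore] -/
theorem lintegral_window_window_sq_lt_top (hTm : Measurable fun p : V3 × Ω => T p.1 p.2)
    (hT : ∀ x, MeasurePreserving (T x) μ μ) {f : Ω → ℝ} (hfm : Measurable f) (hf : MemLp f 2 μ)
    {w : V3 → ℝ} (hwm : Measurable w) (hw0 : ∀ x, 0 ≤ w x) (hwi : Integrable w volume) :
    ∫⁻ q : Ω × (V3 × V3), ENNReal.ofReal (w q.2.1 * w q.2.2 * f (T q.2.1 q.1) ^ 2)
      ∂(μ.prod (volume.prod volume)) < ∞ := by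
  -- measurability of the integrand
  have hTx : Measurable fun q : Ω × (V3 × V3) => T q.2.1 q.1 :=
    hTm.comp (measurable_snd.fst.prodMk measurable_fst)
  have hF : Measurable fun q : Ω × (V3 × V3) => ENNReal.ofReal (w q.2.1 * w q.2.2 * f (T q.2.1 q.1) ^ 2) :=
    (((hwm.comp measurable_snd.fst).mul (hwm.comp measurable_snd.snd)).mul
      ((hfm.comp hTx).pow_const 2)).ennreal_ofReal
  -- Tonelli, integrating `ω` innermost after swapping to `((x, y), ω)`
  rw [lintegral_prod_symm _ hF.aemeasurable]
  have hinner : ∀ p : V3 × V3, ∫⁻ ω, ENNReal.ofReal (w p.1 * w p.2 * f (T p.1 ω) ^ 2) ∂μ =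
      ENNReal.ofReal (w p.1 * w p.2) * ∫⁻ ω, ENNReal.ofReal (f ω ^ 2) ∂μ := by
    intro p
    have e : ∀ ω, ENNReal.ofReal (w p.1 * w p.2 * f (T p.1 ω) ^ 2) =
        ENNReal.ofReal (w p.1 * w p.2) * ENNReal.ofReal (f (T p.1 ω) ^ 2) := fun ω =>
      ENNReal.ofReal_mul (mul_nonneg (hw0 _) (hw0 _))
    simp_rw [e]
    have hm1 : Measurable fun ω => ENNReal.ofReal (f (T p.1 ω) ^ 2) :=
      ((hfm.comp (hT p.1).measurable).pow_const 2).ennreal_ofReal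
    rw [lintegral_const_mul _ hm1]
    congr 1
    exact (hT p.1).lintegral_comp ((hfm.pow_const 2).ennreal_ofReal)
  simp_rw [hinner]
  have hm2 : Measurable fun p : V3 × V3 => ENNReal.ofReal (w p.1 * w p.2) :=
    ((hwm.comp measurable_fst).mul (hwm.comp measurable_snd)).ennreal_ofReal
  rw [lintegral_mul_const _ hm2]
  refine ENNReal.mul_lt_top ?_ ?_
  · -- `∫⁻ w(x) w(y) = (∫⁻ w)²`
    have e : ∀ p : V3 × V3, ENNReal.ofReal (w p.1 * w p.2) = ENNReal.ofReal (w p.1) * ENNReal.ofReal (w p.2) :=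
      fun p => ENNReal.ofReal_mul (hw0 _)
    simp_rw [e]
    rw [lintegral_prod_mul hwm.ennreal_ofReal.aemeasurable hwm.ennreal_ofReal.aemeasurable]
    have hfin : ∫⁻ x, ENNReal.ofReal (w x) ∂(volume : Measure V3) < ∞ := by
      have := hwi.hasFiniteIntegral
      rw [HasFiniteIntegral] at this
      refine lt_of_le_of_lt (lintegral_mono fun x => ?_) this
      rw [Real.enorm_eq_ofReal (hw0 x)]
    exact ENNReal.mul_lt_top hfin hfin
  · have := hf.integrable_sq.hasFiniteIntegral
    rw [HasFiniteIntegral] at this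
    refine lt_of_le_of_lt (lintegral_mono fun ω => ?_) this
    rw [Real.enorm_eq_ofReal (sq_nonneg _)]

/-- **Integrability of the kernel** `(ω, x, y) ↦ w(x) f(T_xω) · w(y) f(T_yω)` on `μ ⊗ (dx ⊗ dy)`. [folklore] -/
theorem integrable_kernel (hTm : Measurable fun p : V3 × Ω => T p.1 p.2)
    (hT : ∀ x, MeasurePreserving (T x) μ μ) {f : Ω → ℝ} (hfm : Measurable f) (hf : MemLp f 2 μ)
    {w : V3 → ℝ} (hwm : Measurable w) (hw0 : ∀ x, 0 ≤ w x) (hwi : Integrable w volume) :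
    Integrable (fun q : Ω × (V3 × V3) => (w q.2.1 * f (T q.2.1 q.1)) * (w q.2.2 * f (T q.2.2 q.1)))
      (μ.prod (volume.prod volume)) := by
  have hTx : Measurable fun q : Ω × (V3 × V3) => T q.2.1 q.1 :=
    hTm.comp (measurable_snd.fst.prodMk measurable_fst)
  have hTy : Measurable fun q : Ω × (V3 × V3) => T q.2.2 q.1 :=
    hTm.comp (measurable_snd.snd.prodMk measurable_fst)
  have hmeas : Measurable fun q : Ω × (V3 × V3) => (w q.2.1 * f (T q.2.1 q.1)) * (w q.2.2 * f (T q.2.2 q.1)) :=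
    ((hwm.comp measurable_snd.fst).mul (hfm.comp hTx)).mul ((hwm.comp measurable_snd.snd).mul (hfm.comp hTy))
  -- the dominating function `w(x)w(y)(f(T_xω)² + f(T_yω)²)/2` is integrable
  have hB1 : Integrable (fun q : Ω × (V3 × V3) => w q.2.1 * w q.2.2 * f (T q.2.1 q.1) ^ 2)
      (μ.prod (volume.prod volume)) := by
    refine ⟨((((hwm.comp measurable_snd.fst).mul (hwm.comp measurable_snd.snd)).mul
      ((hfm.comp hTx).pow_const 2)).aestronglyMeasurable), ?_⟩
    rw [HasFiniteIntegral]
    refine lt_of_le_of_lt (lintegral_mono fun q => ?_) (lintegral_window_window_sq_lt_top hTm hT hfm hf hwm hw0 hwi)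
    rw [Real.enorm_eq_ofReal (mul_nonneg (mul_nonneg (hw0 _) (hw0 _)) (sq_nonneg _))]
  have hB2 : Integrable (fun q : Ω × (V3 × V3) => w q.2.1 * w q.2.2 * f (T q.2.2 q.1) ^ 2)
      (μ.prod (volume.prod volume)) := by
    -- swap `x ↔ y` : a measure-preserving symmetry of `μ ⊗ (dx ⊗ dy)`
    have hswap : MeasurePreserving (fun q : Ω × (V3 × V3) => (q.1, (q.2.2, q.2.1)))
        (μ.prod (volume.prod volume)) (μ.prod (volume.prod volume)) :=
      (MeasurePreserving.id μ).prod (Measure.measurePreserving_swap (μ := (volume : Measure V3))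
        (ν := (volume : Measure V3)))
    have h := (hswap.integrable_comp hB1.aestronglyMeasurable).2 hB1
    refine h.congr (Eventually.of_forall fun q => ?_)
    simp only [Function.comp_apply]
    ring
  refine ((hB1.add hB2).div_const 2).mono' hmeas.aestronglyMeasurable (Eventually.of_forall fun q => ?_)
  rw [Real.norm_eq_abs]
  have h0 : 0 ≤ w q.2.1 * w q.2.2 := mul_nonneg (hw0 _) (hw0 _)
  have key : |(w q.2.1 * f (T q.2.1 q.1)) * (w q.2.2 * f (T q.2.2 q.1))| =
      (w q.2.1 * w q.2.2) * |f (T q.2.1 q.1) * f (T q.2.2 q.1)| := by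
    rw [show (w q.2.1 * f (T q.2.1 q.1)) * (w q.2.2 * f (T q.2.2 q.1)) =
      (w q.2.1 * w q.2.2) * (f (T q.2.1 q.1) * f (T q.2.2 q.1)) by ring, abs_mul, abs_of_nonneg h0]
  rw [key]
  have hab : |f (T q.2.1 q.1) * f (T q.2.2 q.1)| ≤ (f (T q.2.1 q.1) ^ 2 + f (T q.2.2 q.1) ^ 2) / 2 := by
    rw [abs_le]
    constructor <;> nlinarith [sq_nonneg (f (T q.2.1 q.1) + f (T q.2.2 q.1)), sq_nonneg (f (T q.2.1 q.1) - f (T q.2.2 q.1))]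
  calc (w q.2.1 * w q.2.2) * |f (T q.2.1 q.1) * f (T q.2.2 q.1)|
      ≤ (w q.2.1 * w q.2.2) * ((f (T q.2.1 q.1) ^ 2 + f (T q.2.2 q.1) ^ 2) / 2) := mul_le_mul_of_nonneg_left hab h0
    _ = (w q.2.1 * w q.2.2 * f (T q.2.1 q.1) ^ 2 + w q.2.1 * w q.2.2 * f (T q.2.2 q.1) ^ 2) / 2 := by ring

/-- **Positivity at Gaussian scale `a`**: for a centred measurable `f ∈ L²(μ)` (i.e. we use `G(z) = ∫ f · f∘T_z dμ`)
and `a > 0`, `0 ≤ ∫ e^{-a|z|²/2} G(z) dz`. [folklore] -/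
theorem integral_gauss_mul_twoPoint_nonneg (hTm : Measurable fun p : V3 × Ω => T p.1 p.2)
    (hT : ∀ x, MeasurePreserving (T x) μ μ) (hTadd : ∀ x y, T (x + y) = T x ∘ T y)
    {f : Ω → ℝ} (hfm : Measurable f) (hf : MemLp f 2 μ)
    (hG : Integrable (fun z : V3 => ∫ ω, f ω * f (T z ω) ∂μ) volume) {a : ℝ} (ha : 0 < a) :
    0 ≤ ∫ z : V3, rexp (-(a / 2) * ‖z‖ ^ 2) * ∫ ω, f ω * f (T z ω) ∂μ := by
  set w : V3 → ℝ := fun x => rexp (-a * ‖x‖ ^ 2) with hw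
  have hwm : Measurable w := by fun_prop
  have hw0 : ∀ x, 0 ≤ w x := fun x => (Real.exp_pos _).le
  have hwi : Integrable w volume := integrable_gaussWindow ha
  set G : V3 → ℝ := fun z => ∫ ω, f ω * f (T z ω) ∂μ with hGdef
  -- Step 1: `0 ≤ ∫_μ ∫_{dx⊗dy} K`, each inner integral being a square
  set K : Ω → V3 × V3 → ℝ := fun ω p => (w p.1 * f (T p.1 ω)) * (w p.2 * f (T p.2 ω)) with hK
  have hsq : ∀ ω, ∫ p, K ω p ∂((volume : Measure V3).prod volume) =
      (∫ x, w x * f (T x ω)) * ∫ x, w x * f (T x ω) := fun ω =>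
    integral_prod_mul (μ := (volume : Measure V3)) (ν := (volume : Measure V3))
      (fun x => w x * f (T x ω)) (fun y => w y * f (T y ω))
  have h1 : 0 ≤ ∫ ω, ∫ p, K ω p ∂((volume : Measure V3).prod volume) ∂μ :=
    integral_nonneg fun ω => by rw [hsq]; exact mul_self_nonneg _
  -- Step 2: Fubini `μ ↔ (dx ⊗ dy)`
  have hint := integrable_kernel hTm hT hfm hf hwm hw0 hwi
  rw [integral_integral_swap hint] at h1
  -- Step 3: the `μ`-integral of the kernel is `w(x) w(y) G(y - x)`
  have h3 : ∀ p : V3 × V3, ∫ ω, K ω p ∂μ = w p.1 * w p.2 * G (p.2 - p.1) := by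
    intro p
    simp only [hK, hGdef]
    rw [← integral_mul_shift_shift hT hTadd hfm p.1 p.2, ← integral_const_mul]
    refine integral_congr_ae (Eventually.of_forall fun ω => ?_)
    ring
  simp_rw [h3] at h1
  -- Step 4: shear `(x, y) = (x, x + z)` and Fubini on `dx ⊗ dz`
  have hshear := measurePreserving_prod_add (volume : Measure V3) (volume : Measure V3)
  have hGm : AEStronglyMeasurable (fun p : V3 × V3 => w p.1 * w p.2 * G (p.2 - p.1))
      ((volume : Measure V3).prod volume) := by
    refine (((hwm.comp measurable_fst).mul (hwm.comp measurable_snd)).aestronglyMeasurable).mul ?_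
    exact hG.aestronglyMeasurable.comp_quasiMeasurePreserving
      ((quasiMeasurePreserving_sub (volume : Measure V3) (volume : Measure V3)).comp
        (Measure.measurePreserving_swap (μ := (volume : Measure V3))
          (ν := (volume : Measure V3))).quasiMeasurePreserving)
  have h4 : ∫ p : V3 × V3, w p.1 * w p.2 * G (p.2 - p.1) ∂(volume.prod volume) =
      ∫ p : V3 × V3, w p.1 * w (p.1 + p.2) * G p.2 ∂(volume.prod volume) := by
    have key := integral_map hshear.measurable.aemeasurable (by rw [hshear.map_eq]; exact hGm)
    rw [hshear.map_eq] at key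
    rw [key]
    refine integral_congr_ae (Eventually.of_forall fun p => ?_)
    simp only [add_sub_cancel_left]
  rw [h4] at h1
  have hdom : Integrable (fun p : V3 × V3 => w p.1 * w (p.1 + p.2) * G p.2) ((volume : Measure V3).prod volume) := by
    have hprod : Integrable (fun p : V3 × V3 => w p.1 * |G p.2|) ((volume : Measure V3).prod volume) :=
      hwi.mul_prod hG.abs
    refine hprod.mono' ?_ (Eventually.of_forall fun p => ?_)
    · exact (((hwm.comp measurable_fst).mul (hwm.comp (measurable_fst.add measurable_snd))).aestronglyMeasurable).mul
        (hG.aestronglyMeasurable.comp_quasiMeasurePreserving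
          (Measure.quasiMeasurePreserving_snd (μ := (volume : Measure V3)) (ν := (volume : Measure V3))))
    · rw [Real.norm_eq_abs, abs_mul, abs_mul, abs_of_nonneg (hw0 _), abs_of_nonneg (hw0 _)]
      refine mul_le_mul_of_nonneg_right ?_ (abs_nonneg _)
      have : w (p.1 + p.2) ≤ 1 := by
        simp only [hw]
        exact Real.exp_le_one_iff.2 (by nlinarith [sq_nonneg ‖p.1 + p.2‖, ha.le])
      exact mul_le_of_le_one_right (hw0 _) this
  rw [integral_prod_symm _ hdom] at h1
  -- Step 5: the Gaussian autocorrelation `∫ w(x) w(x+z) dx = C · e^{-a|z|²/2}`, `C > 0`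
  have h5 : ∀ z : V3, ∫ x, w x * w (x + z) * G z = (rexp (-(a / 2) * ‖z‖ ^ 2) * G z) *
      ∫ x : V3, rexp (-(2 * a) * ‖x‖ ^ 2) := by
    intro z
    rw [integral_mul_const, integral_gaussWindow_mul_gaussWindow_add a z]
    ring
  simp_rw [h5] at h1
  rw [integral_mul_const] at h1
  exact nonneg_of_mul_nonneg_left h1 (integral_gaussWindow_pos (by linarith))

/-- **Non-negativity of the zero-wavenumber structure factor (Følner / Gaussian-window lemma).** For a jointly
measurable action `T` of `ℝ³` on a probability space by measure-preserving maps (`T_{x+y} = T_x ∘ T_y`), a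
MEASURABLE `f ∈ L²(μ)` whose truncated correlation function `x ↦ Cov_μ(f, f ∘ T_x)` is integrable satisfies
`0 ≤ ∫ Cov_μ(f, f ∘ T_x) dx` — the content of the field `form_self_nonneg` of `FluctuationStructure` (Doyon 2022
Lemma 4.5; Spohn 1991 Part I (7.6)). [folklore] -/
theorem integral_cov_shift_nonneg (hTm : Measurable fun p : V3 × Ω => T p.1 p.2)
    (hT : ∀ x, MeasurePreserving (T x) μ μ) (hTadd : ∀ x y, T (x + y) = T x ∘ T y)
    {f : Ω → ℝ} (hfm : Measurable f) (hf : MemLp f 2 μ)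
    (hg : Integrable (fun x : V3 => cov[f, f ∘ T x; μ]) volume) :
    0 ≤ ∫ x : V3, cov[f, f ∘ T x; μ] := by
  -- centring: `Cov(f, f ∘ T_x) = ∫ f₀ · f₀ ∘ T_x` with `f₀ = f - E f`
  set m : ℝ := ∫ ω, f ω ∂μ with hm
  set f₀ : Ω → ℝ := fun ω => f ω - m with hf₀
  have hf₀m : Measurable f₀ := hfm.sub_const m
  have hf₀2 : MemLp f₀ 2 μ := hf.sub (memLp_const m)
  have hmean : ∀ x, ∫ ω, (f ∘ T x) ω ∂μ = m := by
    intro x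
    have hmeas : AEStronglyMeasurable f (μ.map (T x)) := by rw [(hT x).map_eq]; exact hfm.aestronglyMeasurable
    have := integral_map (hT x).measurable.aemeasurable hmeas
    rw [(hT x).map_eq] at this
    exact this.symm
  have hcov : ∀ x, cov[f, f ∘ T x; μ] = ∫ ω, f₀ ω * f₀ (T x ω) ∂μ := by
    intro x
    simp only [covariance, hmean x]
    rfl
  simp_rw [hcov] at hg ⊢
  -- positivity at every Gaussian scale, then `a → 0⁺` by dominated convergence
  have hpos : ∀ n : ℕ, 0 ≤ ∫ z : V3, rexp (-((1 / ((n : ℝ) + 1)) / 2) * ‖z‖ ^ 2) * ∫ ω, f₀ ω * f₀ (T z ω) ∂μ :=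
    fun n => integral_gauss_mul_twoPoint_nonneg hTm hT hTadd hf₀m hf₀2 hg (by positivity)
  have hlim : Tendsto (fun n : ℕ => ∫ z : V3, rexp (-((1 / ((n : ℝ) + 1)) / 2) * ‖z‖ ^ 2) * ∫ ω, f₀ ω * f₀ (T z ω) ∂μ)
      atTop (𝓝 (∫ z : V3, ∫ ω, f₀ ω * f₀ (T z ω) ∂μ)) := by
    refine tendsto_integral_of_dominated_convergence (fun z => |∫ ω, f₀ ω * f₀ (T z ω) ∂μ|) ?_ hg.abs ?_ ?_
    · intro n
      exact ((by fun_prop : Measurable fun z : V3 => rexp (-((1 / ((n : ℝ) + 1)) / 2) * ‖z‖ ^ 2)).aestronglyMeasurable).mul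
        hg.aestronglyMeasurable
    · intro n
      refine Eventually.of_forall fun z => ?_
      rw [Real.norm_eq_abs, abs_mul, abs_of_nonneg (Real.exp_pos _).le]
      refine mul_le_of_le_one_left (abs_nonneg _) (Real.exp_le_one_iff.2 ?_)
      have : 0 ≤ (1 / ((n : ℝ) + 1)) / 2 := by positivity
      nlinarith [sq_nonneg ‖z‖]
    · refine Eventually.of_forall fun z => ?_
      have h0 : Tendsto (fun n : ℕ => -((1 / ((n : ℝ) + 1)) / 2) * ‖z‖ ^ 2) atTop (𝓝 (-(0 / 2) * ‖z‖ ^ 2)) :=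
        ((tendsto_one_div_add_atTop_nhds_zero_nat.div_const 2).neg.mul_const _)
      have h1 : Tendsto (fun n : ℕ => rexp (-((1 / ((n : ℝ) + 1)) / 2) * ‖z‖ ^ 2)) atTop (𝓝 1) := by
        have := (Real.continuous_exp.tendsto _).comp h0
        simpa [Function.comp_def] using this
      simpa using h1.mul_const (∫ ω, f₀ ω * f₀ (T z ω) ∂μ)
  exact ge_of_tendsto' hlim hpos

end Positivity

/-! ### The registered helper: positivity for the spatial translations of marked configurations -/

/-- **Positivity of the structure factor for the hard-sphere phase space** (helper for the second conjunct of the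
registered stub `stub_momentsAndPositivity`): for every translation-invariant probability measure `μ` on marked
configurations and every MEASURABLE `f ∈ L²(μ)` with integrable truncated correlation function,
`0 ≤ ∫ Cov_μ(f, f ∘ τ_x) dx` (`integral_cov_shift_nonneg` for `spatialShift`, jointly measurable by
`PointConfig.measurable_translate_prod`). [folklore] -/
theorem integral_cov_spatialShift_nonneg :
    ∀ (μ : Measure MarkedConfig), IsProbabilityMeasure μ → (∀ x : V3, MeasurePreserving (spatialShift x) μ μ) →
      ∀ f : MarkedConfig → ℝ, Measurable f → MemLp f 2 μ →
        Integrable (fun x : V3 => cov[f, f ∘ spatialShift x; μ]) volume →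
        0 ≤ ∫ x : V3, cov[f, f ∘ spatialShift x; μ] := by
  intro μ hμ hshift f hfm hf hg
  have hTm : Measurable fun p : V3 × MarkedConfig => spatialShift p.1 p.2 := by
    have hv : Measurable fun p : V3 × MarkedConfig => ((p.1, (0 : V3)) : V3 × V3) :=
      measurable_fst.prodMk measurable_const
    have h : Measurable fun p : V3 × MarkedConfig => (p.2).translate ((p.1, (0 : V3)) : V3 × V3) :=
      Measurable.pointConfig_translate hv measurable_snd
    simpa only [spatialShift_apply] using h
  have hTadd : ∀ x y : V3, (spatialShift (x + y) : MarkedConfig → MarkedConfig) = spatialShift x ∘ spatialShift y :=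
    fun x y => by rw [← ShiftAction.toFun_eq_coe]; exact spatialShift.map_add x y
  exact integral_cov_shift_nonneg hTm hshift hTadd hfm hf hg

end Summit.AtomisticToContinuum.HydrodynamicLimit.Theorems.MourreKoopmanChargesStressStrongMixing

end
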